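import Summits.Ventures.LatticeQCDFlow.Scaling.TwoLevelCycleWords
import Summits.Ventures.LatticeQCDFlow.Scaling.TwoLevelCycleAutomaton
import Summits.Ventures.LatticeQCDFlow.Scaling.RegenerationTagDecay

/-!
HONEST FRAMING: exact (Metropolis-corrected) sampling algorithms for lattice gauge theory; figures
of merit are autocorrelation/cost numbers at stated couplings and volumes; no continuum-physics
claim.

# TwoLevelCycleLaw — THE COLD-START LAW OF THE TWO-LEVEL MAP-ASSISTED EXCHANGE AT THE SPECTRAL RATE: ONE COLD LEVEL, ANY FINITE `S`, ONE MAP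
# `ψ` WITH ONE-SIDED DOMINATION `p·μ_1(ψu) ≤ μ_0(u)`, EXACT HOT REDRAWS, IDLE COLD CONTENT BETWEEN SWAPS:
# `d(n) ≤ 3·(1 − p·t·h/(2(2t+h)))ⁿ` AND `t_mix(ε) ≤ ⌈(2(2t+h)/(p·t·h))·log(3/ε)⌉`, `h = (1−t)w_0` — NO VOLUME, NO LEAST MASS, NO REGIME,
# NO EXTRA FACTOR `h` (lean-2 GEN-31, ours)

Venture-side (OURS).  Cell `lqcd-flow` (pub-lqcd), unit `pub-lqcd-lean-2-g31`, 2026-08-29.  Chapter R, file 4: OPEN-MATH-chapterM item 1 (ii) — the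
factor `h` — SETTLED FOR ONE COLD LEVEL.  Scheme `P = t·GSw + (1−t)·Π_w^M` on `S^{Fin 2}`, `m ≥ 1` entries on the edge `(0,1)` all through the
same bijection `ψ` (`(fun _ => ψ)`; the identity for the label star of chapter Q), exact hot redraws `M_0(u,·) = μ_0`, the idle cold kernel
`M_1 = id` (the cold content moves only by swaps — the label of a sector-confined cold kernel), `0 < t < 1`, `w ≥ 0`, `Σw = 1`, `w_0 > 0`.
`Scaling/TwoLevelRegimeFreeDoeblin` (N18) gave `d(n) ≤ (1 − t·h²·p)^{⌊n/3⌋}` from the rigid pattern REDRAW–SWAP–REDRAW; for `t ≫ h` that is a rate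
`h²p`, one factor `h` below the spectral gap `≍ p·min{t,h}` of `Scaling/TwoLevelFlowExchange` (J15).  HERE: `P = h·R + t·GSw + z·1` as a
three-letter mixture (`twoLevel_scheme_eq_mixture`; `GSw` is the two-point kernel of file 1 by `twoLevel_ptGraphSwap_apply`), so `Pⁿ` is the
mixture over words (file 3); along each word the law is within `(1−p/2)^{N(s)}` of `π̃` (file 2); and the expected multiplier over words of length
`n` is `≤ 3(1 − p·t·h/(2(2t+h)))ⁿ` (file 3 with `β = p/2`).

## What is proved

* §1 `twoLevel_edges_eq`, `twoLevel_proposal_apply`, **`twoLevel_ptGraphSwap_apply`** (the swap kernel is the two-point kernel with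
  `α(x) = min{1, μ_0(ψ⁻¹x_1)μ_1(ψx_0)/(μ_0(x_0)μ_1(x_1))}`, also when `σx = x`), `eq_update_zero_iff_two`, `eq_update_one_iff_two`,
  `twoLevel_prodKernel_apply`, `twoLevel_redraw_stationary`, **`twoLevel_scheme_eq_mixture`**.
* §2 **`twoLevelCycle_worstTvDist_le`** — `d(n) ≤ 3·(1 − p·t·(1−t)w_0/(2(2t+(1−t)w_0)))ⁿ`;
  **`twoLevelCycle_mixingTime_le`** — `t_mix(ε) ≤ ⌈(2(2t+h)/(p·t·h))·log(3/ε)⌉`, `h = (1−t)w_0`, `0 < ε`.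

Reading (no numerics implied): for ONE cold level the cold-start law of the persistent hub has the order of its spectral gap,
`O((1/t + 1/h)·p⁻¹·log(1/ε))`, free of `|S|`, of any least mass and of any regime — the extra `h` of N18 ∕ P12 ∕ Q13 is an artefact of demanding
the redraw IMMEDIATELY before or after the swap; the cold level in fact runs a Barker-or-better independence sampler clocked by the hot
redraws, whatever happens in between (the tree types the independence sampler's rate `1 − 1/w⋆` in
`Literature/Probability/MarkovChains/MengersenTweedie` and Barker's rule in `Literature/Probability/MarkovChains/BarkerAcceptance`; neither is
imported — the mechanism is re-derived as algebra on laws in R1).  At `t = h`: `t_mix(ε) ≤ ⌈(6/(p·t))·log(3/ε)⌉`.  NOT CLAIMED: `K ≥ 2` (OPEN-MATH item 1 (i): for `q ≥ 3`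
contents the levels infect each other through the hub and no two-state structure survives; the `K`-level law free of `log(1/w_min)` stays open),
several distinct maps, a non-idle cold kernel (N18 covers it at its rate), Doeblin hot samplers.  Literature grade (cell rule): OWN RESULT;
nothing cited as a fact; no new bib keys.
-/

noncomputable section

open Finset Function Matrix
open Literature.Probability.MarkovChains

namespace Summit.Ventures.LatticeQCDFlow.Scaling

section Scheme
variable {S : Type*} [Fintype S] [DecidableEq S]
variable {μ : Fin (1 + 1) → S → ℝ} {M : Fin (1 + 1) → S → S → ℝ} {w : Fin (1 + 1) → ℝ} {t p : ℝ} {m : ℕ}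
variable (κ : Fin m → Fin 1) (ψ : Equiv.Perm S)

/-! ## §1 The two-level scheme as a three-letter mixture -/

omit [Fintype S] [DecidableEq S] in
/-- With one cold level every listed hub edge is `(0,1)`. [ours] -/
theorem twoLevel_edges_eq : (fun r : Fin m => (((0 : Fin (1 + 1)), (κ r).succ) : Fin (1 + 1) × Fin (1 + 1)))
    = fun _ => (((0 : Fin (1 + 1)), (1 : Fin (1 + 1))) : Fin (1 + 1) × Fin (1 + 1)) := by
  funext r; rw [Fin.eq_zero (κ r)]; rfl

omit [Fintype S] in
/-- The graph proposal with `m ≥ 1` identical entries `(0,1,ψ)` is the deterministic proposal `x ↦ σx`. [ours] -/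
theorem twoLevel_proposal_apply (hm : 1 ≤ m) (x y : Fin (1 + 1) → S) :
    ptGraphProposal (fun _ : Fin m => (((0 : Fin (1 + 1)), (1 : Fin (1 + 1))) : Fin (1 + 1) × Fin (1 + 1))) (fun _ => ψ) x y
      = if y = edgeFlowSwap ψ 0 1 x then 1 else 0 := by
  unfold ptGraphProposal
  rw [sum_const, card_univ, Fintype.card_fin, nsmul_eq_mul]
  have hmpos : (m : ℝ) ≠ 0 := Nat.cast_ne_zero.mpr (by omega)
  split_ifs
  · field_simp
  · rw [mul_zero]

/-- **THE TWO-LEVEL SWAP KERNEL IS A TWO-POINT KERNEL:** `GSw(x,·) = (1 − α(x))·δ_x + α(x)·δ_{σx}` with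
`α(x) = min{1, μ_0(ψ⁻¹x_1)μ_1(ψx_0)/(μ_0(x_0)μ_1(x_1))}` (also when `σx = x`). [ours] -/
theorem twoLevel_ptGraphSwap_apply (hm : 1 ≤ m) (hμ : ∀ k x, 0 < μ k x) (x y : Fin (1 + 1) → S) :
    ptGraphSwap μ (fun _ : Fin m => (((0 : Fin (1 + 1)), (1 : Fin (1 + 1))) : Fin (1 + 1) × Fin (1 + 1))) (fun _ => ψ) x y
      = (if y = x then 1 - min 1 (μ 0 (ψ.symm (x 1)) * μ 1 (ψ (x 0)) / (μ 0 (x 0) * μ 1 (x 1))) else 0)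
        + (if y = edgeFlowSwap ψ 0 1 x then min 1 (μ 0 (ψ.symm (x 1)) * μ 1 (ψ (x 0)) / (μ 0 (x 0) * μ 1 (x 1))) else 0) := by
  set αx : ℝ := min 1 (μ 0 (ψ.symm (x 1)) * μ 1 (ψ (x 0)) / (μ 0 (x 0) * μ 1 (x 1))) with hαx
  have hπ := tensorFun_pos hμ
  have hratio : tensorFun μ (edgeFlowSwap ψ 0 1 x) / tensorFun μ x
      = μ 0 (ψ.symm (x 1)) * μ 1 (ψ (x 0)) / (μ 0 (x 0) * μ 1 (x 1)) := by
    rw [tensorFun_two, tensorFun_two, (edgeFlowSwap_two_apply ψ x).1, (edgeFlowSwap_two_apply ψ x).2]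
  -- the rate towards any `z`
  have hrate : ∀ z, mhRate (ptGraphProposal (fun _ : Fin m => (((0 : Fin (1 + 1)), (1 : Fin (1 + 1))) : Fin (1 + 1) × Fin (1 + 1)))
      (fun _ => ψ)) (tensorFun μ) x z = if z = edgeFlowSwap ψ 0 1 x then αx else 0 := by
    intro z
    unfold mhRate
    rw [twoLevel_proposal_apply ψ hm, twoLevel_proposal_apply ψ hm,
      if_congr (eq_edgeFlowSwap_two_iff ψ z x) rfl rfl]
    by_cases hz : z = edgeFlowSwap ψ 0 1 x
    · rw [if_pos hz, if_pos hz, mul_one, hz, hratio]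
    · rw [if_neg hz, if_neg hz, mul_zero, zero_div, min_self]
  unfold ptGraphSwap
  by_cases hyx : y = x
  · rw [hyx, mhKernel_self, if_pos rfl]
    simp_rw [hrate]
    rw [Finset.sum_ite_eq' (univ.erase x) (edgeFlowSwap ψ 0 1 x)]
    by_cases hfix : edgeFlowSwap ψ 0 1 x = x
    · rw [if_neg (by rw [hfix]; exact Finset.notMem_erase x univ), if_pos hfix.symm]; ring
    · rw [if_pos (Finset.mem_erase.mpr ⟨hfix, mem_univ _⟩), if_neg (Ne.symm hfix)]; ring
  · rw [mhKernel_of_ne hyx, hrate y, if_neg hyx, zero_add]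

omit [Fintype S] [DecidableEq S] in
/-- On two levels, `y` is `x` updated at level `0` iff the cold contents agree. [ours] -/
theorem eq_update_zero_iff_two (x y : Fin (1 + 1) → S) : y = update x 0 (y 0) ↔ y 1 = x 1 := by
  constructor
  · intro h
    have := congrFun h 1
    rwa [update_of_ne (by decide : (1 : Fin (1 + 1)) ≠ 0)] at this
  · intro h
    funext i
    rcases Fin.eq_zero_or_eq_succ i with hi | ⟨j, hj⟩
    · rw [hi, update_self]
    · rw [Fin.eq_zero j] at hj
      rw [hj, show (Fin.succ 0 : Fin (1 + 1)) = 1 from rfl, update_of_ne (by decide : (1 : Fin (1 + 1)) ≠ 0), h]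

omit [Fintype S] [DecidableEq S] in
/-- On two levels with an idle cold kernel, the level-`1` coordinate kernel is the identity. [ours] -/
theorem eq_update_one_iff_two (x y : Fin (1 + 1) → S) : (y = update x 1 (y 1) ∧ y 1 = x 1) ↔ y = x := by
  constructor
  · rintro ⟨h, h1⟩
    rw [h, h1, update_eq_self]
  · intro h
    subst h
    exact ⟨(update_eq_self 1 y).symm, rfl⟩

omit [Fintype S] in
/-- **The update part on two levels:** `Π_w^M(x,y) = w_0·μ_0(y_0)𝟙{y_1 = x_1} + w_1·𝟙{y = x}` for the exact hot redraw and the idle cold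
kernel. [ours] -/
theorem twoLevel_prodKernel_apply (hM0 : ∀ u v, M 0 u v = μ 0 v) (hM1 : ∀ u v, M 1 u v = if v = u then 1 else 0)
    (x y : Fin (1 + 1) → S) :
    prodKernel w M x y = w 0 * (if y 1 = x 1 then μ 0 (y 0) else 0) + w 1 * (if y = x then 1 else 0) := by
  rw [prodKernel_apply, Fin.sum_univ_two]
  congr 1
  · unfold coordKernel
    rw [if_congr (eq_update_zero_iff_two x y) (hM0 _ _) rfl]
  · unfold coordKernel
    rw [hM1]
    by_cases h : y = x
    · rw [if_pos h, if_pos ((eq_update_one_iff_two x y).mpr h).1, if_pos ((eq_update_one_iff_two x y).mpr h).2]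
    · rw [if_neg h]
      by_cases h' : y = update x 1 (y 1)
      · rw [if_pos h', if_neg (fun h1 => h ((eq_update_one_iff_two x y).mp ⟨h', h1⟩))]
      · rw [if_neg h']

/-- The hot redraw fixes `π̃ = μ_0 ⊗ μ_1`. [ours] -/
theorem twoLevel_redraw_stationary (hμ1 : ∑ u, μ 0 u = 1) (y : Fin (1 + 1) → S) :
    ∑ x : Fin (1 + 1) → S, tensorFun μ x * (if y 1 = x 1 then μ 0 (y 0) else 0) = tensorFun μ y := by
  rw [sum_two_level, tensorFun_two]
  simp only [Matrix.cons_val_one, Matrix.cons_val_zero, tensorFun_two, mul_ite, mul_zero]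
  simp_rw [Finset.sum_ite_eq univ (y 1), if_pos (mem_univ _)]
  rw [← sum_mul, ← sum_mul, hμ1, one_mul, mul_comm]

/-- **THE TWO-LEVEL SCHEME IS A THREE-LETTER MIXTURE:** `P = h·R + t·GSw + z·1` as matrices, `h = (1−t)w_0`, `z = (1−t)w_1`
(exact hot redraw `R`, idle cold kernel). [ours] -/
theorem twoLevel_scheme_eq_mixture (hM0 : ∀ u v, M 0 u v = μ 0 v) (hM1 : ∀ u v, M 1 u v = if v = u then 1 else 0)
    (kk : Fin 3 → Matrix (Fin (1 + 1) → S) (Fin (1 + 1) → S) ℝ)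
    (hkk0 : ∀ x y, kk 0 x y = if y 1 = x 1 then μ 0 (y 0) else 0)
    (hkk1 : ∀ x y, kk 1 x y
      = ptGraphSwap μ (fun _ : Fin m => (((0 : Fin (1 + 1)), (1 : Fin (1 + 1))) : Fin (1 + 1) × Fin (1 + 1))) (fun _ => ψ) x y)
    (hkk2 : kk 2 = 1) (cw : Fin 3 → ℝ) (hc0 : cw 0 = (1 - t) * w 0) (hc1 : cw 1 = t) (hc2 : cw 2 = (1 - t) * w 1) :
    (Matrix.of fun a b : Fin (1 + 1) → S =>
      t * ptGraphSwap μ (fun _ : Fin m => (((0 : Fin (1 + 1)), (1 : Fin (1 + 1))) : Fin (1 + 1) × Fin (1 + 1))) (fun _ => ψ) a b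
        + (1 - t) * prodKernel w M a b) = ∑ a, cw a • kk a := by
  ext a b
  rw [Fin.sum_univ_three, Matrix.of_apply, Matrix.add_apply, Matrix.add_apply, Matrix.smul_apply, Matrix.smul_apply,
    Matrix.smul_apply, smul_eq_mul, smul_eq_mul, smul_eq_mul, hc0, hc1, hc2, hkk0, hkk1, hkk2, Matrix.one_apply,
    twoLevel_prodKernel_apply hM0 hM1, if_congr (eq_comm (a := b) (b := a)) rfl rfl]
  ring

/-! ## §2 The cold-start law and the mixing time -/

/-- **THE COLD-START LAW OF THE TWO-LEVEL MAP-ASSISTED EXCHANGE AT THE SPECTRAL RATE.**  One cold level, any finite `S`, `m ≥ 1` entries all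
swapping through ONE bijection `ψ` with one-sided domination `p·μ_1(ψu) ≤ μ_0(u)` (`0 < p ≤ 1`), exact hot redraws `M_0(u,·) = μ_0`, idle
cold content between swaps (`M_1 = id`), `0 < t < 1`, `w ≥ 0`, `Σw = 1`, `w_0 > 0`, `h = (1−t)w_0`:
**`d(n) ≤ 3·(1 − p·t·h/(2(2t+h)))ⁿ`** — NO `|S|`, NO least mass, NO regime, and NO extra factor `h`. [ours] -/
theorem twoLevelCycle_worstTvDist_le [Nonempty S] (hm : 1 ≤ m) (hμ : ∀ k x, 0 < μ k x) (hμ1 : ∀ k, ∑ u, μ k u = 1)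
    (hM0 : ∀ u v, M 0 u v = μ 0 v) (hM1 : ∀ u v, M 1 u v = if v = u then 1 else 0)
    (hw0 : ∀ k, 0 ≤ w k) (hw00 : 0 < w 0) (hw1 : ∑ k, w k = 1) (ht0 : 0 < t) (ht1 : t < 1)
    (hp0 : 0 < p) (hp1 : p ≤ 1) (hdom : ∀ u, p * μ 1 (ψ u) ≤ μ 0 u) (n : ℕ) :
    worstTvDist (fun a b : Fin (1 + 1) → S =>
        t * ptGraphSwap μ (fun r : Fin m => (((0 : Fin (1 + 1)), (κ r).succ) : Fin (1 + 1) × Fin (1 + 1))) (fun _ => ψ) a b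
          + (1 - t) * prodKernel w M a b) (tensorFun μ) n
      ≤ 3 * (1 - p * t * ((1 - t) * w 0) / (2 * (2 * t + (1 - t) * w 0))) ^ n := by
  rw [twoLevel_edges_eq κ]
  have hh0 : 0 < (1 - t) * w 0 := mul_pos (by linarith) hw00
  have hz0 : 0 ≤ (1 - t) * w 1 := mul_nonneg (by linarith) (hw0 1)
  have hw01 : w 0 + w 1 = 1 := by rw [← hw1, Fin.sum_univ_two]
  have hthz : t + (1 - t) * w 0 + (1 - t) * w 1 = 1 := by nlinarith [hw01]
  -- the three letters: hot redraw, ring, idle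
  obtain ⟨kk, hkk⟩ : ∃ kk : Fin 3 → Matrix (Fin (1 + 1) → S) (Fin (1 + 1) → S) ℝ, kk =
      ![Matrix.of fun a b : Fin (1 + 1) → S => if b 1 = a 1 then μ 0 (b 0) else 0,
        Matrix.of fun a b => ptGraphSwap μ
          (fun _ : Fin m => (((0 : Fin (1 + 1)), (1 : Fin (1 + 1))) : Fin (1 + 1) × Fin (1 + 1))) (fun _ => ψ) a b, 1] :=
    ⟨_, rfl⟩
  have hkk0 : ∀ x y, kk 0 x y = if y 1 = x 1 then μ 0 (y 0) else 0 := fun x y => by rw [hkk]; rfl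
  have hkk1' : ∀ x y, kk 1 x y
      = ptGraphSwap μ (fun _ : Fin m => (((0 : Fin (1 + 1)), (1 : Fin (1 + 1))) : Fin (1 + 1) × Fin (1 + 1))) (fun _ => ψ) x y :=
    fun x y => by rw [hkk]; rfl
  have hkk1 : ∀ x y, kk 1 x y = (if y = x then 1 - min 1 (μ 0 (ψ.symm (x 1)) * μ 1 (ψ (x 0)) / (μ 0 (x 0) * μ 1 (x 1))) else 0)
      + (if y = edgeFlowSwap ψ 0 1 x then min 1 (μ 0 (ψ.symm (x 1)) * μ 1 (ψ (x 0)) / (μ 0 (x 0) * μ 1 (x 1))) else 0) :=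
    fun x y => by rw [hkk1', twoLevel_ptGraphSwap_apply ψ hm hμ]
  have hkk2 : kk 2 = 1 := by rw [hkk]; rfl
  obtain ⟨cw, hcw⟩ : ∃ cw : Fin 3 → ℝ, cw = ![(1 - t) * w 0, t, (1 - t) * w 1] := ⟨_, rfl⟩
  have hc0 : cw 0 = (1 - t) * w 0 := by rw [hcw]; rfl
  have hc1 : cw 1 = t := by rw [hcw]; rfl
  have hc2 : cw 2 = (1 - t) * w 1 := by rw [hcw]; rfl
  have hP := twoLevel_scheme_eq_mixture (t := t) ψ hM0 hM1 kk hkk0 hkk1' hkk2 cw hc0 hc1 hc2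
  have hstat : ∀ c, tensorFun μ ᵥ* kk c = tensorFun μ := by
    have hfin3 : ∀ j : Fin 3, j = 0 ∨ j = 1 ∨ j = 2 := by decide
    intro c
    rcases hfin3 c with rfl | rfl | rfl
    · funext y; rw [vecMul_apply_two]; simp_rw [hkk0]; exact twoLevel_redraw_stationary (hμ1 0) y
    · funext y; rw [vecMul_apply_two]; simp_rw [hkk1']
      exact (ptGraphSwap_detailedBalance hμ).isStationary (ptGraphSwap_isRowStochastic hμ).2 y
    · rw [hkk2]; exact Matrix.vecMul_one _
  -- the bookkeeping automaton
  obtain ⟨δ, hδ⟩ : ∃ δ : Fin 3 → Fin 3 → Fin 3, δ = fun i c =>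
      if c = 0 then 1 else if c = 2 then i else (if i = 0 then 0 else if i = 1 then 2 else 1) := ⟨_, rfl⟩
  have hδ0 : ∀ i, δ i 0 = 1 := fun i => by rw [hδ]; simp
  have hδ2 : ∀ i, δ i 2 = i := fun i => by rw [hδ]; simp
  have hδ01 : δ 0 1 = 0 := by rw [hδ]; simp
  have hδ11 : δ 1 1 = 2 := by rw [hδ]; simp
  have hδ21 : δ 2 1 = 1 := by rw [hδ]; simp
  -- the bookkeeping objects (opaque names) and states
  obtain ⟨ainf, hainf⟩ : ∃ ainf : S → S → ℝ, ainf = fun v d =>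
      min 1 (μ 0 (ψ.symm d) * μ 1 (ψ v) / (μ 0 v * μ 1 d)) / (min 1 (μ 0 (ψ.symm d) * μ 1 (ψ v) / (μ 0 v * μ 1 d))
        + min 1 (μ 0 (ψ.symm (ψ v)) * μ 1 (ψ (ψ.symm d)) / (μ 0 (ψ.symm d) * μ 1 (ψ v)))) := ⟨_, rfl⟩
  obtain ⟨ms, hms⟩ : ∃ ms : (S → ℝ) → (S → S → ℝ) → (Fin (1 + 1) → S) → ℝ, ms = fun lam a y =>
      lam (y 1) * μ 0 (y 0) * (1 - a (y 0) (y 1)) + lam (ψ (y 0)) * μ 0 (ψ.symm (y 1)) * a (ψ.symm (y 1)) (ψ (y 0)) :=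
    ⟨_, rfl⟩
  have hRep : ∀ (P0 P1 P2 : ((Fin (1 + 1) → S) → ℝ) → Prop),
      (∀ ρ, ((0 : Fin 3) = 0 ∧ P0 ρ ∨ (0 : Fin 3) = 1 ∧ P1 ρ ∨ (0 : Fin 3) = 2 ∧ P2 ρ) ↔ P0 ρ) ∧
      (∀ ρ, ((1 : Fin 3) = 0 ∧ P0 ρ ∨ (1 : Fin 3) = 1 ∧ P1 ρ ∨ (1 : Fin 3) = 2 ∧ P2 ρ) ↔ P1 ρ) ∧
      (∀ ρ, ((2 : Fin 3) = 0 ∧ P0 ρ ∨ (2 : Fin 3) = 1 ∧ P1 ρ ∨ (2 : Fin 3) = 2 ∧ P2 ρ) ↔ P2 ρ) := by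
    intro P0 P1 P2
    refine ⟨fun ρ => ?_, fun ρ => ?_, fun ρ => ?_⟩ <;> simp
  have hR3 := hRep (fun ρ => (∀ y, 0 ≤ ρ y) ∧ ∑ y, ρ y = 1)
    (fun ρ => ∃ (lam : S → ℝ) (a : S → S → ℝ), (∀ u, 0 ≤ lam u) ∧ ∑ u, lam u = 1 ∧
      (∀ v d, 0 ≤ a v d ∧ a v d ≤ ainf v d) ∧ ρ = ms lam a)
    (fun ρ => ∃ (lam : S → ℝ) (a : S → S → ℝ), (∀ u, 0 ≤ lam u) ∧ ∑ u, lam u = 1 ∧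
      (∀ v d, ainf v d ≤ a v d ∧ a v d ≤ 1) ∧ ρ = ms lam a)
  -- per-word bound
  have hword : ∀ (x : Fin (1 + 1) → S) (s : Fin n → Fin 3),
      tvDist (fun y => ((List.ofFn s).map kk).prod x y) (tensorFun μ)
        ≤ ((List.ofFn s).foldl (fun st c => (δ st.1 c, st.2 * (fun i c : Fin 3 => if i = 2 ∧ c = 0 then 1 - p / 2 else (1 : ℝ))
          st.1 c)) (0, 1)).2 := fun x s =>
    cycle_word_tvDist ψ hμ hμ1 hp1 hdom (fun v d => min 1 (μ 0 (ψ.symm d) * μ 1 (ψ v) / (μ 0 v * μ 1 d))) (fun _ _ => rfl)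
      ainf (fun v d => by rw [hainf]) ms (fun lam a y => by rw [hms])
      (fun i ρ => (i = 0 ∧ ((∀ y, 0 ≤ ρ y) ∧ ∑ y, ρ y = 1)) ∨
        (i = 1 ∧ ∃ (lam : S → ℝ) (a : S → S → ℝ), (∀ u, 0 ≤ lam u) ∧ ∑ u, lam u = 1 ∧
          (∀ v d, 0 ≤ a v d ∧ a v d ≤ ainf v d) ∧ ρ = ms lam a) ∨
        (i = 2 ∧ ∃ (lam : S → ℝ) (a : S → S → ℝ), (∀ u, 0 ≤ lam u) ∧ ∑ u, lam u = 1 ∧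
          (∀ v d, ainf v d ≤ a v d ∧ a v d ≤ 1) ∧ ρ = ms lam a))
      hR3.1 hR3.2.1 hR3.2.2 kk hkk0 hkk1 hkk2 hstat δ hδ0 hδ2 hδ01 hδ11 hδ21 _ (fun _ _ => rfl) x (List.ofFn s)
  have hwt0 : ∀ s : Fin n → Fin 3, 0 ≤ ∏ j, cw (s j) := fun s => prod_nonneg fun j _ => by
    rcases (by decide : ∀ j : Fin 3, j = 0 ∨ j = 1 ∨ j = 2) (s j) with h' | h' | h' <;> rw [h']
    · rw [hc0]; exact hh0.le
    · rw [hc1]; exact ht0.le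
    · rw [hc2]; exact hz0
  have hwt1 : ∑ s : Fin n → Fin 3, ∏ j, cw (s j) = 1 := by
    rw [sum_words_weight, Fin.sum_univ_three, hc0, hc1, hc2, show (1 - t) * w 0 + t + (1 - t) * w 1 = 1 by linarith, one_pow]
  refine ciSup_le fun x => ?_
  have h00 : lawAt (fun a b : Fin (1 + 1) → S =>
      t * ptGraphSwap μ (fun _ : Fin m => (((0 : Fin (1 + 1)), (1 : Fin (1 + 1))) : Fin (1 + 1) × Fin (1 + 1))) (fun _ => ψ) a b
        + (1 - t) * prodKernel w M a b) (Pi.single x 1) n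
      = fun y => ((Matrix.of fun a b : Fin (1 + 1) → S =>
          t * ptGraphSwap μ (fun _ : Fin m => (((0 : Fin (1 + 1)), (1 : Fin (1 + 1))) : Fin (1 + 1) × Fin (1 + 1))) (fun _ => ψ) a b
            + (1 - t) * prodKernel w M a b) ^ n) x y :=
    funext fun y => kernelAt_eq_pow_apply (Matrix.of fun a b : Fin (1 + 1) → S =>
      t * ptGraphSwap μ (fun _ : Fin m => (((0 : Fin (1 + 1)), (1 : Fin (1 + 1))) : Fin (1 + 1) × Fin (1 + 1))) (fun _ => ψ) a b
        + (1 - t) * prodKernel w M a b) n x y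
  have h0 : lawAt (fun a b : Fin (1 + 1) → S =>
      t * ptGraphSwap μ (fun _ : Fin m => (((0 : Fin (1 + 1)), (1 : Fin (1 + 1))) : Fin (1 + 1) × Fin (1 + 1))) (fun _ => ψ) a b
        + (1 - t) * prodKernel w M a b) (Pi.single x 1) n
      = fun y => ∑ s : Fin n → Fin 3, (∏ j, cw (s j)) * ((List.ofFn s).map kk).prod x y := by
    rw [h00]
    funext y
    rw [hP, mixture_pow_eq_sum_words, Matrix.sum_apply]
    exact sum_congr rfl fun s _ => by rw [Matrix.smul_apply, smul_eq_mul]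
  rw [h0]
  have h1 := tvDist_sum_smul_le univ (fun s : Fin n → Fin 3 => ∏ j, cw (s j)) (fun s _ => hwt0 s) hwt1
    (fun (s : Fin n → Fin 3) (y : Fin (1 + 1) → S) => ((List.ofFn s).map kk).prod x y) (tensorFun μ)
  have h2 : ∑ s : Fin n → Fin 3, (∏ j, cw (s j)) * tvDist (fun y => ((List.ofFn s).map kk).prod x y) (tensorFun μ)
      ≤ ∑ s : Fin n → Fin 3, (∏ j, cw (s j))
          * ((List.ofFn s).foldl (fun st c => (δ st.1 c, st.2 * (fun i c : Fin 3 => if i = 2 ∧ c = 0 then 1 - p / 2 else (1 : ℝ))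
            st.1 c)) (0, 1)).2 :=
    sum_le_sum fun s _ => mul_le_mul_of_nonneg_left (hword x s) (hwt0 s)
  have hc2' : cw 2 = 1 - t - (1 - t) * w 0 := by rw [hc2]; linarith
  have h3 := cycle_mult_sum_le (β := p / 2) ht0 hh0 (by linarith) (by linarith) (by linarith) δ hδ0 hδ2 hδ01 hδ11 hδ21
    (fun i c : Fin 3 => if i = 2 ∧ c = 0 then 1 - p / 2 else (1 : ℝ)) (fun _ _ => rfl) cw hc0 hc1 hc2' n
  have h4 : t * ((1 - t) * w 0) * (p / 2) / (2 * t + (1 - t) * w 0)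
      = p * t * ((1 - t) * w 0) / (2 * (2 * t + (1 - t) * w 0)) := by
    rw [div_eq_div_iff (by linarith) (by linarith)]
    ring
  rw [← h4]
  exact h1.trans (h2.trans h3)

/-- **THE MIXING TIME:** `t_mix(ε) ≤ ⌈(2(2t+h)/(p·t·h))·log(3/ε)⌉` (`h = (1−t)w_0`, `0 < ε`) — `O((1/t + 1/h)·p⁻¹·log(1/ε))`, the order of
the spectral rate `p·min{t,h}` of `Scaling/TwoLevelFlowExchange`, now for the cold start in total variation. [ours] -/
theorem twoLevelCycle_mixingTime_le [Nonempty S] (hm : 1 ≤ m) (hμ : ∀ k x, 0 < μ k x) (hμ1 : ∀ k, ∑ u, μ k u = 1)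
    (hM0 : ∀ u v, M 0 u v = μ 0 v) (hM1 : ∀ u v, M 1 u v = if v = u then 1 else 0)
    (hw0 : ∀ k, 0 ≤ w k) (hw00 : 0 < w 0) (hw1 : ∑ k, w k = 1) (ht0 : 0 < t) (ht1 : t < 1)
    (hp0 : 0 < p) (hp1 : p ≤ 1) (hdom : ∀ u, p * μ 1 (ψ u) ≤ μ 0 u) {ε : ℝ} (hε : 0 < ε) :
    mixingTime (fun a b : Fin (1 + 1) → S =>
        t * ptGraphSwap μ (fun r : Fin m => (((0 : Fin (1 + 1)), (κ r).succ) : Fin (1 + 1) × Fin (1 + 1))) (fun _ => ψ) a b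
          + (1 - t) * prodKernel w M a b) (tensorFun μ) ε
      ≤ ⌈1 / (p * t * ((1 - t) * w 0) / (2 * (2 * t + (1 - t) * w 0))) * Real.log (3 / ε)⌉₊ := by
  set h : ℝ := (1 - t) * w 0 with hh
  have hh0 : 0 < h := mul_pos (by linarith) hw00
  have hρ0 : 0 < p * t * h / (2 * (2 * t + h)) := by positivity
  have hρ1 : p * t * h / (2 * (2 * t + h)) ≤ 1 := by
    rw [div_le_one (by positivity)]
    have h1 : h ≤ 1 := by
      have : w 0 ≤ 1 := by
        calc w 0 ≤ ∑ k, w k := single_le_sum (f := fun k => w k) (fun k _ => hw0 k) (mem_univ 0)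
          _ = 1 := hw1
      rw [hh]; nlinarith
    nlinarith [mul_le_mul_of_nonneg_left h1 (mul_nonneg hp0.le ht0.le), mul_nonneg hp0.le ht0.le,
      mul_le_mul_of_nonneg_right hp1 ht0.le]
  refine mixingTime_le _ _ ((twoLevelCycle_worstTvDist_le κ ψ hm hμ hμ1 hM0 hM1 hw0 hw00 hw1 ht0 ht1 hp0 hp1 hdom _).trans ?_)
  exact geom_le_of_ge_log hρ0 hρ1 (by norm_num) hε (Nat.le_ceil _)

end Scheme

end Summit.Ventures.LatticeQCDFlow.Scaling

end
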